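import Mathlib
import Summits.NavierStokesRegularity.NavierStokesRegularity.Theorems.EulerZoomLiouvillePowerGaugeEulerLiouvilleWindowCubicAE
import Summits.NavierStokesRegularity.NavierStokesRegularity.Theorems.EulerZoomLiouvillePowerGaugeEulerLiouvillePressureSplitWindowAE
import Summits.NavierStokesRegularity.NavierStokesRegularity.Theorems.EulerZoomLiouvillePowerGaugeEulerLiouvilleWindowFluxBoundsSplit
import HarnessLib

/-!
# One-ball window flux bound from a SLICE ENERGY PROFILE `A r^s` (a.e. in time): rate `a^{s + 5/6}`, every `ρ ≥ 0`
# (crux `EulerZoomLiouville.PowerGaugeEulerLiouville` = stmt-NavierStokesRegularity-19832, lead's line `birth`)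

Route `EulerZoomLiouville` (NavierStokesRegularity).  Infrastructure for the BOOTSTRAP IN SCALE of the flux strata (lead
report v5, successor target S1).  The `A`-gauge gives every member the slice profile `∫_{B_r}|u(t)|² ≤ c r^{1−2ρ}`; the energy
inequality from a quiescent/finite-energy start improves the profile's exponent, and the improvement feeds back through the
one-ball flux bound.  This file is the profile-parametrised one-ball bound: if `∫_{B_r}|u(t)|² ≤ A r^s` for a.e. `t` in the
window and all `r ≥ 1` (`0 ≤ s ≤ 1`), then

* `exists_oneBall_window_le_of_sliceExponent` — `∫∫_{(α,β)×B_a} (|u|³ + 2|p||u|) ≤ M(c, A, β−α) · a^{s + 5/6}` for `a ≥ 1`,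
  `−a² ≤ α < β ≤ 0`, EVERY `ρ ≥ 0`.

So the flux through the sphere of radius `a` over the window is `≲ a^{s − 1/6}`: each bootstrap step lowers the slice exponent
by `1/6`, uniformly in `ρ`.  WHAT THIS IS NOT: not NS, not the open core; a helper `--supports` stmt-19832. [folklore]
-/

noncomputable section

set_option linter.dupNamespace false

open MeasureTheory Set Filter Topology Metric Function TopologicalSpace
open scoped ENNReal NNReal

namespace Summit.NavierStokesRegularity.NavierStokesRegularity.Theorems.PowerGaugeEulerLiouville

open Literature.Analysis Literature.Analysis.FunctionSpaces Literature.Analysis.FluidPDE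

/-! ## Exponent bookkeeping (`a ≥ 1`, `ρ ≥ 0`, `0 ≤ s ≤ 1`): everything is at most `a^{s + 5/6}` -/

/-- `(a^s)^{3/4} (a^{1−ρ})^{3/4} ≤ a^{s+5/6}`. [folklore] -/
theorem rpow_se_cubic_le {a ρ s : ℝ} (ha : 1 ≤ a) (hρ : 0 ≤ ρ) (hs : 0 ≤ s) :
    (a ^ s) ^ (3 / 4 : ℝ) * (a ^ (1 - ρ)) ^ (3 / 4 : ℝ) ≤ a ^ (s + 5 / 6) := by
  have ha0 : 0 < a := lt_of_lt_of_le one_pos ha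
  rw [← Real.rpow_mul ha0.le, ← Real.rpow_mul ha0.le, ← Real.rpow_add ha0]
  refine Real.rpow_le_rpow_of_exponent_le ha ?_
  nlinarith

/-- `(a^s)^{3/2} ≤ a^{s+5/6}` for `s ≤ 1`. [folklore] -/
theorem rpow_se_cubic2_le {a s : ℝ} (ha : 1 ≤ a) (hs1 : s ≤ 1) :
    (a ^ s) ^ (3 / 2 : ℝ) ≤ a ^ (s + 5 / 6) := by
  have ha0 : 0 < a := lt_of_lt_of_le one_pos ha
  rw [← Real.rpow_mul ha0.le]
  refine Real.rpow_le_rpow_of_exponent_le ha ?_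
  nlinarith

/-- `a⁻³ ((a^s)^{1/2} (a³)^{1/2}) · (a³)^{1/3} (a^{2−2ρ})^{2/3} = a^{5/6 + s/2 − 4ρ/3} ≤ a^{s+5/6}`. [folklore] -/
theorem rpow_se_harmonic_le {a ρ s : ℝ} (ha : 1 ≤ a) (hρ : 0 ≤ ρ) (hs : 0 ≤ s) :
    (a ^ 3)⁻¹ * ((a ^ s) ^ (1 / 2 : ℝ) * (a ^ 3) ^ (1 / 2 : ℝ)) *
        ((a ^ 3) ^ (1 / 3 : ℝ) * (a ^ (2 - 2 * ρ)) ^ (2 / 3 : ℝ)) ≤ a ^ (s + 5 / 6) := by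
  have ha0 : 0 < a := lt_of_lt_of_le one_pos ha
  have h3 : (a ^ 3 : ℝ) = a ^ (3 : ℝ) := by rw [← Real.rpow_natCast]; norm_num
  rw [h3, ← Real.rpow_neg_one (a ^ (3 : ℝ)), ← Real.rpow_mul ha0.le, ← Real.rpow_mul ha0.le,
    ← Real.rpow_mul ha0.le, ← Real.rpow_mul ha0.le, ← Real.rpow_mul ha0.le,
    ← Real.rpow_add ha0, ← Real.rpow_add ha0, ← Real.rpow_add ha0, ← Real.rpow_add ha0]
  refine Real.rpow_le_rpow_of_exponent_le ha ?_
  nlinarith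

/-- `a⁻³ ((a^s)^{1/2} (a³)^{1/2}) · a (a^{s+5/6})^{2/3} = a^{7s/6 + 1/18} ≤ a^{s+5/6}` for `s ≤ 1`. [folklore] -/
theorem rpow_se_remainder_le {a s : ℝ} (ha : 1 ≤ a) (hs1 : s ≤ 1) :
    (a ^ 3)⁻¹ * ((a ^ s) ^ (1 / 2 : ℝ) * (a ^ 3) ^ (1 / 2 : ℝ)) * (a * (a ^ (s + 5 / 6)) ^ (2 / 3 : ℝ)) ≤
      a ^ (s + 5 / 6) := by
  have ha0 : 0 < a := lt_of_lt_of_le one_pos ha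
  have h3 : (a ^ 3 : ℝ) = a ^ (3 : ℝ) := by rw [← Real.rpow_natCast]; norm_num
  have h1 : ∀ e : ℝ, a * a ^ e = a ^ (1 + e) := fun e => by rw [Real.rpow_add ha0, Real.rpow_one]
  rw [h3, ← Real.rpow_neg_one (a ^ (3 : ℝ)), ← Real.rpow_mul ha0.le, ← Real.rpow_mul ha0.le,
    ← Real.rpow_mul ha0.le, ← Real.rpow_mul ha0.le, h1, ← Real.rpow_add ha0, ← Real.rpow_add ha0,
    ← Real.rpow_add ha0]
  refine Real.rpow_le_rpow_of_exponent_le ha ?_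
  nlinarith

/-- `(2a)^{s+5/6} ≤ 4 a^{s+5/6}` for `a ≥ 0`, `s ≤ 1`. [folklore] -/
theorem rpow_se_two_mul_le {a s : ℝ} (ha : 0 ≤ a) (hs1 : s ≤ 1) :
    (2 * a) ^ (s + 5 / 6) ≤ 4 * a ^ (s + 5 / 6) := by
  rw [Real.mul_rpow (by norm_num) ha]
  refine mul_le_mul_of_nonneg_right ?_ (Real.rpow_nonneg ha _)
  calc (2 : ℝ) ^ (s + 5 / 6) ≤ 2 ^ (2 : ℝ) := Real.rpow_le_rpow_of_exponent_le (by norm_num) (by linarith)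
    _ = 4 := by norm_num

/-! ## The one-ball flux mass under a slice energy profile -/

/-- **One-ball window flux mass under the slice energy profile `A r^s` (a.e. in time): rate `a^{s+5/6}`, every
`ρ ≥ 0`** (see the file docstring). [folklore] -/
theorem exists_oneBall_window_le_of_sliceExponent {ρ : ℝ} (hρ : 0 ≤ ρ) {s : ℝ} (hs0 : 0 ≤ s) (hs1 : s ≤ 1)
    {u : ℝ → EuclideanSpace ℝ (Fin 3) → EuclideanSpace ℝ (Fin 3)} {p : ℝ → EuclideanSpace ℝ (Fin 3) → ℝ}
    {H : ℝ → EuclideanSpace ℝ (Fin 3) → EuclideanSpace ℝ (Fin 3) →L[ℝ] EuclideanSpace ℝ (Fin 3)} {c : ℝ≥0}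
    (hsw : IsSuitableWeakSolutionOn (slab (EuclideanSpace ℝ (Fin 3)) (Iio 0) isOpen_Iio) 0 0 u p)
    (hH : HasWeakSpatialGradientOn (slab (EuclideanSpace ℝ (Fin 3)) (Iio 0) isOpen_Iio) u H)
    (hc : ∀ a : ℝ, 0 < a → ENNReal.ofReal (a ^ (2 * ρ)) * cknA a (0 : ℝ × EuclideanSpace ℝ (Fin 3)) u +
        ENNReal.ofReal (a ^ ρ) * cknE a (0 : ℝ × EuclideanSpace ℝ (Fin 3)) H +
        ENNReal.ofReal (a ^ (2 * ρ)) * cknD a (0 : ℝ × EuclideanSpace ℝ (Fin 3)) p ≤ (c : ℝ≥0∞))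
    {α β : ℝ} (hαβ : α < β) (hβ : β ≤ 0) {A : ℝ≥0}
    (hAs : ∀ᵐ t ∂(volume.restrict (Ioo α β)), ∀ r : ℝ, 1 ≤ r →
      ∫⁻ x in ball (0 : EuclideanSpace ℝ (Fin 3)) r, ‖u t x‖ₑ ^ 2 ≤ ENNReal.ofReal ((A : ℝ) * r ^ s)) :
    ∃ M : ℝ, 0 ≤ M ∧ ∀ a : ℝ, 1 ≤ a → -(a ^ 2) ≤ α →
      ∫⁻ z in Ioo α β ×ˢ ball (0 : EuclideanSpace ℝ (Fin 3)) a,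
          (‖u z.1 z.2‖ₑ ^ (3 : ℕ) + 2 * (‖p z.1 z.2‖ₑ * ‖u z.1 z.2‖ₑ)) ≤
        ENNReal.ofReal (M * a ^ (s + 5 / 6)) := by
  obtain ⟨Kc, hKct, hKc⟩ := exists_lintegral_cube_window_ball_le_of_sliceEnergy_ae
  obtain ⟨c₅, hc₅⟩ := exists_lintegral_pressure_velocity_window_le_split_ae
  have hL : 0 < β - α := by linarith
  set L : ℝ := β - α with hLdef
  -- gauge components
  have hE : ∀ a : ℝ, 0 < a →
      ENNReal.ofReal (a ^ ρ) * cknE a (0 : ℝ × EuclideanSpace ℝ (Fin 3)) H ≤ (c : ℝ≥0∞) :=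
    fun a ha => le_trans (le_trans le_add_self le_self_add) (hc a ha)
  have hD : ∀ a : ℝ, 0 < a →
      ENNReal.ofReal (a ^ (2 * ρ)) * cknD a (0 : ℝ × EuclideanSpace ℝ (Fin 3)) p ≤ (c : ℝ≥0∞) :=
    fun a ha => le_trans le_add_self (hc a ha)
  have hpm : AEStronglyMeasurable (uncurry p)
      (volume.restrict (Iio (0 : ℝ) ×ˢ (univ : Set (EuclideanSpace ℝ (Fin 3))))) := by
    have := hsw.distributional.2.2.1.aestronglyMeasurable
    simpa [slab] using this
  have hum : AEStronglyMeasurable (uncurry u)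
      (volume.restrict (Iio (0 : ℝ) ×ˢ (univ : Set (EuclideanSpace ℝ (Fin 3))))) := by
    have := hH.locallyIntegrableOn.aestronglyMeasurable
    simpa [slab] using this
  -- the constants
  set V₁ : ℝ≥0∞ := volume (ball (0 : EuclideanSpace ℝ (Fin 3)) 1) with hV₁
  have hV₁t : V₁ ≠ ⊤ := measure_ball_lt_top.ne
  have hV₁0 : V₁ ≠ 0 := (measure_ball_pos volume _ one_pos).ne'
  set Ee : ℝ≥0∞ := ENNReal.ofReal (A : ℝ) with hEe
  have hEet : Ee ≠ ⊤ := ENNReal.ofReal_ne_top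
  have hA0 : 0 ≤ (A : ℝ) := A.2
  set X₁ : ℝ≥0∞ := Kc * (Ee ^ (3 / 4 : ℝ) * ENNReal.ofReal (c : ℝ) ^ (3 / 4 : ℝ) * ENNReal.ofReal L ^ (1 / 4 : ℝ) +
    ENNReal.ofReal L * V₁⁻¹ ^ (1 / 2 : ℝ) * Ee ^ (3 / 2 : ℝ)) with hX₁
  have hX₁t : X₁ ≠ ⊤ := by
    refine ENNReal.mul_ne_top hKct (ENNReal.add_ne_top.2 ⟨?_, ?_⟩)
    · exact ENNReal.mul_ne_top (ENNReal.mul_ne_top (ENNReal.rpow_ne_top_of_nonneg (by norm_num) hEet)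
        (ENNReal.rpow_ne_top_of_nonneg (by norm_num) ENNReal.ofReal_ne_top))
        (ENNReal.rpow_ne_top_of_nonneg (by norm_num) ENNReal.ofReal_ne_top)
    · exact ENNReal.mul_ne_top (ENNReal.mul_ne_top ENNReal.ofReal_ne_top
        (ENNReal.rpow_ne_top_of_nonneg (by norm_num) (ENNReal.inv_ne_top.2 hV₁0))) (ENNReal.rpow_ne_top_of_nonneg (by norm_num) hEet)
  set X₂ : ℝ≥0∞ := X₁ * ENNReal.ofReal 4 with hX₂
  have hX₂t : X₂ ≠ ⊤ := ENNReal.mul_ne_top hX₁t ENNReal.ofReal_ne_top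
  set Sc : ℝ≥0∞ := Ee ^ (1 / 2 : ℝ) * V₁ ^ (1 / 2 : ℝ) with hSc
  have hSct : Sc ≠ ⊤ := ENNReal.mul_ne_top (ENNReal.rpow_ne_top_of_nonneg (by norm_num) hEet)
    (ENNReal.rpow_ne_top_of_nonneg (by norm_num) hV₁t)
  set X₄ : ℝ≥0∞ := ENNReal.ofReal ((c : ℝ) * 4) ^ (2 / 3 : ℝ) *
    (ENNReal.ofReal L * ENNReal.ofReal 8 * V₁) ^ (1 / 3 : ℝ) with hX₄
  have hX₄t : X₄ ≠ ⊤ := ENNReal.mul_ne_top (ENNReal.rpow_ne_top_of_nonneg (by norm_num) ENNReal.ofReal_ne_top)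
    (ENNReal.rpow_ne_top_of_nonneg (by norm_num)
      (ENNReal.mul_ne_top (ENNReal.mul_ne_top ENNReal.ofReal_ne_top ENNReal.ofReal_ne_top) hV₁t))
  set X₅ : ℝ≥0∞ := Sc * (ENNReal.ofReal 2 * ENNReal.ofReal L ^ (1 / 3 : ℝ) * X₂ ^ (2 / 3 : ℝ)) with hX₅
  have hX₅t : X₅ ≠ ⊤ := ENNReal.mul_ne_top hSct (ENNReal.mul_ne_top
    (ENNReal.mul_ne_top ENNReal.ofReal_ne_top (ENNReal.rpow_ne_top_of_nonneg (by norm_num) ENNReal.ofReal_ne_top))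
    (ENNReal.rpow_ne_top_of_nonneg (by norm_num) hX₂t))
  set Γ : ℝ≥0∞ := X₁ + 2 * ((c₅ : ℝ≥0∞) * (X₂ + Sc * X₄ + X₅)) with hΓ
  have hΓt : Γ ≠ ⊤ := ENNReal.add_ne_top.2 ⟨hX₁t, ENNReal.mul_ne_top (by norm_num)
    (ENNReal.mul_ne_top ENNReal.coe_ne_top (ENNReal.add_ne_top.2 ⟨ENNReal.add_ne_top.2
      ⟨hX₂t, ENNReal.mul_ne_top hSct hX₄t⟩, hX₅t⟩))⟩
  refine ⟨Γ.toReal, ENNReal.toReal_nonneg, fun a ha hα => ?_⟩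
  have ha0 : 0 < a := lt_of_lt_of_le one_pos ha
  have h2a1 : 1 ≤ 2 * a := by linarith
  have h2a0 : 0 < 2 * a := by linarith
  have hα2 : -((2 * a) ^ 2) ≤ α := by nlinarith
  set σ : ℝ := s + 5 / 6 with hσ
  set A₁ : ℝ≥0∞ := ENNReal.ofReal (a ^ σ) with hA₁
  have has : 0 ≤ a ^ σ := Real.rpow_nonneg ha0.le _
  set W : Set ℝ := Ioo α β with hW
  have hd : Module.finrank ℝ (EuclideanSpace ℝ (Fin 3)) = 3 := by simp
  have hVr : ∀ r : ℝ, 0 < r → volume (ball (0 : EuclideanSpace ℝ (Fin 3)) r) = ENNReal.ofReal (r ^ 3) * V₁ := by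
    intro r hr; rw [Measure.addHaar_ball_of_pos volume _ hr, hd]
  -- slice energy on balls: `∫_{B_r} |u(t)|² ≤ A r^s` for a.e. `t ∈ (α, β)`, `r ≥ 1`
  have hslice : ∀ r : ℝ, 1 ≤ r → ∀ᵐ t ∂(volume.restrict W),
      ∫⁻ x in ball (0 : EuclideanSpace ℝ (Fin 3)) r, ‖u t x‖ₑ ^ 2 ≤ Ee * ENNReal.ofReal (r ^ s) := by
    intro r hr
    filter_upwards [hAs] with t ht
    rw [hEe, ← ENNReal.ofReal_mul hA0]
    exact ht r hr
  -- ## (1)-(2) the cubic masses on `B_r`, `r ≥ 1`, `−r² ≤ α`: `≤ X₁ · r^{5/6}`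
  have hcub : ∀ r : ℝ, 1 ≤ r → -(r ^ 2) ≤ α →
      ∫⁻ z in W ×ˢ ball (0 : EuclideanSpace ℝ (Fin 3)) r, ‖u z.1 z.2‖ₑ ^ (3 : ℕ) ≤ X₁ * ENNReal.ofReal (r ^ σ) := by
    intro r hr hrα
    have hr0 : 0 < r := lt_of_lt_of_le one_pos hr
    have hrs0 : 0 ≤ r ^ s := Real.rpow_nonneg hr0.le _
    have h := hKc ρ u H c (Ee * ENNReal.ofReal (r ^ s)) (ENNReal.mul_ne_top hEet ENNReal.ofReal_ne_top)
      hH hE r α β hr0 hrα hαβ hβ (hslice r hr)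
    rw [← hLdef] at h
    refine h.trans ?_
    -- first term: `(A r^s)^{3/4} (c r^{1-ρ})^{3/4} ≤ A^{3/4} c^{3/4} r^{s+5/6}`
    have h1 : (Ee * ENNReal.ofReal (r ^ s)) ^ (3 / 4 : ℝ) * ENNReal.ofReal ((c : ℝ) * r ^ (1 - ρ)) ^ (3 / 4 : ℝ) ≤
        Ee ^ (3 / 4 : ℝ) * ENNReal.ofReal (c : ℝ) ^ (3 / 4 : ℝ) * ENNReal.ofReal (r ^ σ) := by
      rw [ENNReal.ofReal_mul (NNReal.coe_nonneg c), ENNReal.mul_rpow_of_nonneg _ _ (by norm_num : (0:ℝ) ≤ 3 / 4),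
        ENNReal.mul_rpow_of_nonneg _ _ (by norm_num : (0:ℝ) ≤ 3 / 4),
        ENNReal.ofReal_rpow_of_nonneg hrs0 (by norm_num : (0:ℝ) ≤ 3 / 4),
        ENNReal.ofReal_rpow_of_nonneg (Real.rpow_nonneg hr0.le _) (by norm_num : (0:ℝ) ≤ 3 / 4)]
      calc Ee ^ (3 / 4 : ℝ) * ENNReal.ofReal ((r ^ s) ^ (3 / 4 : ℝ)) *
            (ENNReal.ofReal (c : ℝ) ^ (3 / 4 : ℝ) * ENNReal.ofReal ((r ^ (1 - ρ)) ^ (3 / 4 : ℝ)))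
          = Ee ^ (3 / 4 : ℝ) * ENNReal.ofReal (c : ℝ) ^ (3 / 4 : ℝ) *
              ENNReal.ofReal ((r ^ s) ^ (3 / 4 : ℝ) * (r ^ (1 - ρ)) ^ (3 / 4 : ℝ)) := by
            rw [ENNReal.ofReal_mul (Real.rpow_nonneg hrs0 _)]; ring
        _ ≤ Ee ^ (3 / 4 : ℝ) * ENNReal.ofReal (c : ℝ) ^ (3 / 4 : ℝ) * ENNReal.ofReal (r ^ σ) :=
            mul_le_mul' le_rfl (ENNReal.ofReal_le_ofReal (rpow_se_cubic_le hr hρ hs0))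
    -- second term: `|B_r|^{-1/2} (A r^s)^{3/2} ≤ |B_1|^{-1/2} A^{3/2} r^{s+5/6}`
    have h2 : (volume (ball (0 : EuclideanSpace ℝ (Fin 3)) r))⁻¹ ^ (1 / 2 : ℝ) * (Ee * ENNReal.ofReal (r ^ s)) ^ (3 / 2 : ℝ) ≤
        V₁⁻¹ ^ (1 / 2 : ℝ) * Ee ^ (3 / 2 : ℝ) * ENNReal.ofReal (r ^ σ) := by
      have hle : V₁ ≤ volume (ball (0 : EuclideanSpace ℝ (Fin 3)) r) := by
        rw [hVr r hr0]
        refine le_mul_of_one_le_left zero_le ?_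
        rw [← ENNReal.ofReal_one]; exact ENNReal.ofReal_le_ofReal (one_le_pow₀ hr)
      have hv : (volume (ball (0 : EuclideanSpace ℝ (Fin 3)) r))⁻¹ ^ (1 / 2 : ℝ) ≤ V₁⁻¹ ^ (1 / 2 : ℝ) :=
        ENNReal.rpow_le_rpow (ENNReal.inv_le_inv.2 hle) (by norm_num)
      rw [ENNReal.mul_rpow_of_nonneg _ _ (by norm_num : (0:ℝ) ≤ 3 / 2),
        ENNReal.ofReal_rpow_of_nonneg hrs0 (by norm_num : (0:ℝ) ≤ 3 / 2)]
      calc (volume (ball (0 : EuclideanSpace ℝ (Fin 3)) r))⁻¹ ^ (1 / 2 : ℝ) *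
            (Ee ^ (3 / 2 : ℝ) * ENNReal.ofReal ((r ^ s) ^ (3 / 2 : ℝ)))
          ≤ V₁⁻¹ ^ (1 / 2 : ℝ) * (Ee ^ (3 / 2 : ℝ) * ENNReal.ofReal (r ^ σ)) :=
            mul_le_mul' hv (mul_le_mul' le_rfl (ENNReal.ofReal_le_ofReal (rpow_se_cubic2_le hr hs1)))
        _ = V₁⁻¹ ^ (1 / 2 : ℝ) * Ee ^ (3 / 2 : ℝ) * ENNReal.ofReal (r ^ σ) := by ring
    calc Kc * ((Ee * ENNReal.ofReal (r ^ s)) ^ (3 / 4 : ℝ) * ENNReal.ofReal ((c : ℝ) * r ^ (1 - ρ)) ^ (3 / 4 : ℝ) *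
            ENNReal.ofReal L ^ (1 / 4 : ℝ) +
          ENNReal.ofReal L * (volume (ball (0 : EuclideanSpace ℝ (Fin 3)) r))⁻¹ ^ (1 / 2 : ℝ) *
            (Ee * ENNReal.ofReal (r ^ s)) ^ (3 / 2 : ℝ))
        = Kc * (((Ee * ENNReal.ofReal (r ^ s)) ^ (3 / 4 : ℝ) * ENNReal.ofReal ((c : ℝ) * r ^ (1 - ρ)) ^ (3 / 4 : ℝ)) *
            ENNReal.ofReal L ^ (1 / 4 : ℝ) +
          ENNReal.ofReal L * ((volume (ball (0 : EuclideanSpace ℝ (Fin 3)) r))⁻¹ ^ (1 / 2 : ℝ) *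
            (Ee * ENNReal.ofReal (r ^ s)) ^ (3 / 2 : ℝ))) := by ring
      _ ≤ Kc * ((Ee ^ (3 / 4 : ℝ) * ENNReal.ofReal (c : ℝ) ^ (3 / 4 : ℝ) * ENNReal.ofReal (r ^ σ)) *
            ENNReal.ofReal L ^ (1 / 4 : ℝ) +
          ENNReal.ofReal L * (V₁⁻¹ ^ (1 / 2 : ℝ) * Ee ^ (3 / 2 : ℝ) * ENNReal.ofReal (r ^ σ))) := by
          gcongr
      _ = X₁ * ENNReal.ofReal (r ^ σ) := by rw [hX₁]; ring
  have h1 : ∫⁻ z in W ×ˢ ball (0 : EuclideanSpace ℝ (Fin 3)) a, ‖u z.1 z.2‖ₑ ^ (3 : ℕ) ≤ X₁ * A₁ := hcub a ha hα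
  set Iu : ℝ≥0∞ := ∫⁻ z in W ×ˢ ball (0 : EuclideanSpace ℝ (Fin 3)) (2 * a), ‖u z.1 z.2‖ₑ ^ (3 : ℕ) with hIu
  have h2 : Iu ≤ X₂ * A₁ := by
    have h := hcub (2 * a) h2a1 hα2
    have h' : X₁ * ENNReal.ofReal ((2 * a) ^ σ) ≤ X₁ * (ENNReal.ofReal 4 * A₁) := by
      rw [hA₁, ← ENNReal.ofReal_mul (by norm_num : (0:ℝ) ≤ 4)]
      exact mul_le_mul' le_rfl (ENNReal.ofReal_le_ofReal (rpow_se_two_mul_le ha0.le hs1))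
    have e : X₁ * (ENNReal.ofReal 4 * A₁) = X₂ * A₁ := by
      simp only [hX₂, hX₁]; ring
    exact h.trans (h'.trans e.le)
  have hIut : Iu < ⊤ := lt_of_le_of_lt h2 (ENNReal.mul_lt_top hX₂t.lt_top ENNReal.ofReal_lt_top)
  -- ## (3) the velocity mass `∫_{B_a} |u(t)| ≤ Sc · (a^s)^{1/2} (a³)^{1/2}` for a.e. `t`
  set Sa : ℝ := (a ^ s) ^ (1 / 2 : ℝ) * (a ^ 3) ^ (1 / 2 : ℝ) with hSa
  have hSa0 : 0 ≤ Sa := by positivity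
  have has0 : 0 ≤ a ^ s := Real.rpow_nonneg ha0.le _
  have hS : ∀ᵐ t ∂(volume.restrict (Ioo α β)),
      ∫⁻ x in ball (0 : EuclideanSpace ℝ (Fin 3)) (2 * a / 2), ‖u t x‖ₑ ≤ Sc * ENNReal.ofReal Sa := by
    filter_upwards [hslice a ha] with t ht
    rw [show 2 * a / 2 = a by ring]
    refine (setLIntegral_le_sqrt_mul_sqrt volume _ _).trans ?_
    rw [hVr a ha0]
    calc (∫⁻ x in ball (0 : EuclideanSpace ℝ (Fin 3)) a, ‖u t x‖ₑ ^ 2) ^ (1 / 2 : ℝ) *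
          (ENNReal.ofReal (a ^ 3) * V₁) ^ (1 / 2 : ℝ)
        ≤ (Ee * ENNReal.ofReal (a ^ s)) ^ (1 / 2 : ℝ) * (ENNReal.ofReal (a ^ 3) * V₁) ^ (1 / 2 : ℝ) := by
          gcongr
      _ = Sc * ENNReal.ofReal Sa := by
          rw [hSc, hSa, ENNReal.mul_rpow_of_nonneg _ _ (by norm_num : (0:ℝ) ≤ 1 / 2),
            ENNReal.mul_rpow_of_nonneg _ _ (by norm_num : (0:ℝ) ≤ 1 / 2),
            ENNReal.ofReal_rpow_of_nonneg has0 (by norm_num : (0:ℝ) ≤ 1 / 2),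
            ENNReal.ofReal_rpow_of_nonneg (pow_nonneg ha0.le 3) (by norm_num : (0:ℝ) ≤ 1 / 2),
            ENNReal.ofReal_mul (Real.rpow_nonneg has0 _)]
          ring
  -- ## (4) the `D`-gauge: `∫∫_{W×B_{2a}} |p|^{3/2} ≤ c·4·a^{2−2ρ}`, and the `L¹` form
  set I32 : ℝ≥0∞ := ∫⁻ z in W ×ˢ ball (0 : EuclideanSpace ℝ (Fin 3)) (2 * a), ‖p z.1 z.2‖ₑ ^ (3 / 2 : ℝ) with hI32
  have hWQ : W ×ˢ ball (0 : EuclideanSpace ℝ (Fin 3)) (2 * a) ⊆ parabolicCylinder (2 * a) (0 : ℝ × EuclideanSpace ℝ (Fin 3)) := by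
    intro z hz
    simp only [parabolicCylinder, mem_prod, mem_Ioo, mem_ball, Prod.fst_zero, Prod.snd_zero, zero_sub] at hz ⊢
    exact ⟨⟨lt_of_le_of_lt hα2 hz.1.1, lt_of_lt_of_le hz.1.2 hβ⟩, mem_ball.1 hz.2⟩
  have h4 : I32 ≤ ENNReal.ofReal ((c : ℝ) * 4) * ENNReal.ofReal (a ^ (2 - 2 * ρ)) := by
    have h1' := hD (2 * a) h2a0
    have hpos : 0 < (2 * a) ^ (2 * ρ) * ((2 * a) ^ 2)⁻¹ := by positivity
    have hcoef : ENNReal.ofReal ((2 * a) ^ (2 * ρ)) * (ENNReal.ofReal (2 * a) ^ 2)⁻¹ =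
        ENNReal.ofReal ((2 * a) ^ (2 * ρ) * ((2 * a) ^ 2)⁻¹) := by
      rw [← ENNReal.ofReal_pow h2a0.le, ← ENNReal.ofReal_inv_of_pos (by positivity),
        ← ENNReal.ofReal_mul (Real.rpow_nonneg h2a0.le _)]
    unfold cknD at h1'
    rw [← mul_assoc, hcoef] at h1'
    have h2' : ∫⁻ q in parabolicCylinder (2 * a) (0 : ℝ × EuclideanSpace ℝ (Fin 3)), ‖p q.1 q.2‖ₑ ^ (3 / 2 : ℝ) ≤
        (c : ℝ≥0∞) / ENNReal.ofReal ((2 * a) ^ (2 * ρ) * ((2 * a) ^ 2)⁻¹) := by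
      rw [ENNReal.le_div_iff_mul_le (Or.inl ((ENNReal.ofReal_pos.2 hpos).ne')) (Or.inl ENNReal.ofReal_ne_top),
        mul_comm]
      exact h1'
    have hJ : ∫⁻ q in parabolicCylinder (2 * a) (0 : ℝ × EuclideanSpace ℝ (Fin 3)), ‖p q.1 q.2‖ₑ ^ (3 / 2 : ℝ) ≤
        ENNReal.ofReal ((c : ℝ) * (2 * a) ^ (2 - 2 * ρ)) := by
      refine h2'.trans (le_of_eq ?_)
      rw [ENNReal.coe_nnreal_eq, ← ENNReal.ofReal_div_of_pos hpos]
      congr 1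
      rw [div_eq_mul_inv, mul_inv, inv_inv, Real.rpow_sub h2a0, Real.rpow_two, div_eq_mul_inv]
      ring
    refine ((lintegral_mono_set hWQ).trans hJ).trans ?_
    rw [← ENNReal.ofReal_mul (by positivity)]
    refine ENNReal.ofReal_le_ofReal ?_
    rw [Real.mul_rpow (by norm_num) ha0.le, mul_assoc]
    refine mul_le_mul_of_nonneg_left (mul_le_mul_of_nonneg_right ?_ (Real.rpow_nonneg ha0.le _)) c.2
    calc (2 : ℝ) ^ (2 - 2 * ρ) ≤ 2 ^ (2 : ℝ) := Real.rpow_le_rpow_of_exponent_le (by norm_num) (by linarith)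
      _ = 4 := by norm_num
  have hI32t : I32 < ⊤ := lt_of_le_of_lt h4 (ENNReal.mul_lt_top ENNReal.ofReal_lt_top ENNReal.ofReal_lt_top)
  set Ip : ℝ≥0∞ := ∫⁻ z in W ×ˢ ball (0 : EuclideanSpace ℝ (Fin 3)) (2 * a), ‖p z.1 z.2‖ₑ with hIp
  set Pa : ℝ := (a ^ 3) ^ (1 / 3 : ℝ) * (a ^ (2 - 2 * ρ)) ^ (2 / 3 : ℝ) with hPa
  have hPa0 : 0 ≤ Pa := by positivity
  have h5 : Ip ≤ X₄ * ENNReal.ofReal Pa := by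
    set μ : Measure (ℝ × EuclideanSpace ℝ (Fin 3)) := volume.restrict (W ×ˢ ball (0 : EuclideanSpace ℝ (Fin 3)) (2 * a)) with hμ
    have hWs : W ×ˢ ball (0 : EuclideanSpace ℝ (Fin 3)) (2 * a) ⊆ Iio (0:ℝ) ×ˢ (univ : Set (EuclideanSpace ℝ (Fin 3))) :=
      prod_mono (fun s hs => lt_of_lt_of_le hs.2 hβ) (subset_univ _)
    have hp' : AEMeasurable (fun z : ℝ × EuclideanSpace ℝ (Fin 3) => ‖p z.1 z.2‖ₑ) μ :=
      (hpm.mono_measure (Measure.restrict_mono hWs le_rfl)).aemeasurable.enorm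
    have hpq : Real.HolderConjugate (3 / 2 : ℝ) 3 := ⟨by norm_num, by norm_num, by norm_num⟩
    have hH' := ENNReal.lintegral_mul_le_Lp_mul_Lq μ hpq hp' (aemeasurable_const (b := (1 : ℝ≥0∞)))
    simp only [Pi.mul_apply, mul_one, ENNReal.one_rpow, lintegral_const, one_mul] at hH'
    have hμu : μ univ = ENNReal.ofReal L * ENNReal.ofReal 8 * ENNReal.ofReal (a ^ 3) * V₁ := by
      rw [hμ, Measure.restrict_apply_univ, Measure.volume_eq_prod, Measure.prod_prod, Real.volume_Ioo, hVr (2 * a) h2a0,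
        ← hLdef, show (2 * a) ^ 3 = 8 * a ^ 3 by ring, ENNReal.ofReal_mul (by norm_num : (0:ℝ) ≤ 8)]
      ring
    refine hH'.trans ?_
    rw [hμu, show (1 / (3 / 2 : ℝ)) = 2 / 3 by norm_num]
    calc I32 ^ (2 / 3 : ℝ) * (ENNReal.ofReal L * ENNReal.ofReal 8 * ENNReal.ofReal (a ^ 3) * V₁) ^ (1 / (3 : ℝ))
        ≤ (ENNReal.ofReal ((c : ℝ) * 4) * ENNReal.ofReal (a ^ (2 - 2 * ρ))) ^ (2 / 3 : ℝ) *
            (ENNReal.ofReal L * ENNReal.ofReal 8 * ENNReal.ofReal (a ^ 3) * V₁) ^ (1 / (3 : ℝ)) := by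
          gcongr
      _ = X₄ * ENNReal.ofReal Pa := by
          rw [hX₄, hPa, show (1 / (3 : ℝ)) = 1 / 3 by norm_num,
            ENNReal.mul_rpow_of_nonneg _ _ (by norm_num : (0:ℝ) ≤ 2 / 3),
            show ENNReal.ofReal L * ENNReal.ofReal 8 * ENNReal.ofReal (a ^ 3) * V₁ =
              (ENNReal.ofReal L * ENNReal.ofReal 8 * V₁) * ENNReal.ofReal (a ^ 3) by ring,
            ENNReal.mul_rpow_of_nonneg _ _ (by norm_num : (0:ℝ) ≤ 1 / 3),
            ENNReal.ofReal_rpow_of_nonneg (Real.rpow_nonneg ha0.le _) (by norm_num : (0:ℝ) ≤ 2 / 3),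
            ENNReal.ofReal_rpow_of_nonneg (pow_nonneg ha0.le 3) (by norm_num : (0:ℝ) ≤ 1 / 3),
            ENNReal.ofReal_mul (Real.rpow_nonneg (pow_nonneg ha0.le 3) _)]
          ring
  -- ## (5) the window pressure bound at `r = 2a`
  have hP := hc₅ 0 u p (2 * a) α β (Sc * ENNReal.ofReal Sa) h2a0 hαβ hβ hsw.distributional hS hI32t hIut
  rw [show 2 * a / 2 = a by ring] at hP
  -- ## (6) folding the two pressure remainders into `a^{5/6}`
  have hR : ENNReal.ofReal (((2 * a) ^ 3)⁻¹) ≤ ENNReal.ofReal ((a ^ 3)⁻¹) := by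
    refine ENNReal.ofReal_le_ofReal (inv_anti₀ (pow_pos ha0 3) ?_)
    gcongr; linarith
  have hB : ENNReal.ofReal ((a ^ 3)⁻¹) * (Sc * ENNReal.ofReal Sa) * (X₄ * ENNReal.ofReal Pa) ≤ Sc * X₄ * A₁ := by
    have e : ENNReal.ofReal ((a ^ 3)⁻¹) * (Sc * ENNReal.ofReal Sa) * (X₄ * ENNReal.ofReal Pa) =
        Sc * X₄ * (ENNReal.ofReal ((a ^ 3)⁻¹) * ENNReal.ofReal Sa * ENNReal.ofReal Pa) := by ring
    rw [e, ← ENNReal.ofReal_mul (inv_nonneg.2 (pow_nonneg ha0.le 3)), ← ENNReal.ofReal_mul (by positivity)]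
    refine mul_le_mul' le_rfl (ENNReal.ofReal_le_ofReal ?_)
    rw [hSa, hPa]
    exact rpow_se_harmonic_le ha hρ hs0
  have hC : ENNReal.ofReal ((a ^ 3)⁻¹) * (Sc * ENNReal.ofReal Sa) *
      (ENNReal.ofReal (2 * a) * ENNReal.ofReal (β - α) ^ (1 / 3 : ℝ) * Iu ^ (2 / 3 : ℝ)) ≤ X₅ * A₁ := by
    have hIu23 : Iu ^ (2 / 3 : ℝ) ≤ X₂ ^ (2 / 3 : ℝ) * ENNReal.ofReal ((a ^ σ) ^ (2 / 3 : ℝ)) := by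
      calc Iu ^ (2 / 3 : ℝ) ≤ (X₂ * A₁) ^ (2 / 3 : ℝ) := by gcongr
        _ = X₂ ^ (2 / 3 : ℝ) * ENNReal.ofReal ((a ^ σ) ^ (2 / 3 : ℝ)) := by
            rw [ENNReal.mul_rpow_of_nonneg _ _ (by norm_num : (0:ℝ) ≤ 2 / 3), hA₁,
              ENNReal.ofReal_rpow_of_nonneg has (by norm_num : (0:ℝ) ≤ 2 / 3)]
    rw [ENNReal.ofReal_mul (by norm_num : (0:ℝ) ≤ 2), ← hLdef]
    calc ENNReal.ofReal ((a ^ 3)⁻¹) * (Sc * ENNReal.ofReal Sa) *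
          (ENNReal.ofReal 2 * ENNReal.ofReal a * ENNReal.ofReal L ^ (1 / 3 : ℝ) * Iu ^ (2 / 3 : ℝ))
        ≤ ENNReal.ofReal ((a ^ 3)⁻¹) * (Sc * ENNReal.ofReal Sa) *
          (ENNReal.ofReal 2 * ENNReal.ofReal a * ENNReal.ofReal L ^ (1 / 3 : ℝ) *
            (X₂ ^ (2 / 3 : ℝ) * ENNReal.ofReal ((a ^ σ) ^ (2 / 3 : ℝ)))) := by gcongr
      _ = X₅ * (ENNReal.ofReal ((a ^ 3)⁻¹) * ENNReal.ofReal Sa * ENNReal.ofReal a *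
            ENNReal.ofReal ((a ^ σ) ^ (2 / 3 : ℝ))) := by rw [hX₅]; ring
      _ = X₅ * ENNReal.ofReal ((a ^ 3)⁻¹ * Sa * (a * (a ^ σ) ^ (2 / 3 : ℝ))) := by
          rw [← ENNReal.ofReal_mul (inv_nonneg.2 (pow_nonneg ha0.le 3))]
          congr 1
          rw [ENNReal.ofReal_mul (mul_nonneg (inv_nonneg.2 (pow_nonneg ha0.le 3)) hSa0),
            ENNReal.ofReal_mul ha0.le]
          ring
      _ ≤ X₅ * A₁ := by
          refine mul_le_mul' le_rfl (ENNReal.ofReal_le_ofReal ?_)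
          rw [hSa, hσ]
          exact rpow_se_remainder_le ha hs1
  have hPle : ∫⁻ z in W ×ˢ ball (0 : EuclideanSpace ℝ (Fin 3)) a, ‖p z.1 z.2‖ₑ * ‖u z.1 z.2‖ₑ ≤
      (c₅ : ℝ≥0∞) * (X₂ + Sc * X₄ + X₅) * A₁ := by
    refine hP.trans ?_
    calc (c₅ : ℝ≥0∞) * (Iu + ENNReal.ofReal (((2 * a) ^ 3)⁻¹) * (Sc * ENNReal.ofReal Sa) *
            (Ip + ENNReal.ofReal (2 * a) * ENNReal.ofReal (β - α) ^ (1 / 3 : ℝ) * Iu ^ (2 / 3 : ℝ)))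
        ≤ (c₅ : ℝ≥0∞) * (X₂ * A₁ + ENNReal.ofReal ((a ^ 3)⁻¹) * (Sc * ENNReal.ofReal Sa) *
            (X₄ * ENNReal.ofReal Pa +
              ENNReal.ofReal (2 * a) * ENNReal.ofReal (β - α) ^ (1 / 3 : ℝ) * Iu ^ (2 / 3 : ℝ))) := by
          gcongr
      _ = (c₅ : ℝ≥0∞) * (X₂ * A₁ + (ENNReal.ofReal ((a ^ 3)⁻¹) * (Sc * ENNReal.ofReal Sa) * (X₄ * ENNReal.ofReal Pa) +
            ENNReal.ofReal ((a ^ 3)⁻¹) * (Sc * ENNReal.ofReal Sa) *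
              (ENNReal.ofReal (2 * a) * ENNReal.ofReal (β - α) ^ (1 / 3 : ℝ) * Iu ^ (2 / 3 : ℝ)))) := by
          rw [mul_add (ENNReal.ofReal ((a ^ 3)⁻¹) * (Sc * ENNReal.ofReal Sa))]
      _ ≤ (c₅ : ℝ≥0∞) * (X₂ * A₁ + (Sc * X₄ * A₁ + X₅ * A₁)) := by gcongr
      _ = (c₅ : ℝ≥0∞) * (X₂ + Sc * X₄ + X₅) * A₁ := by ring
  -- ## (7) assembly
  have hWs : W ×ˢ ball (0 : EuclideanSpace ℝ (Fin 3)) a ⊆ Iio (0:ℝ) ×ˢ (univ : Set (EuclideanSpace ℝ (Fin 3))) :=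
    prod_mono (fun s hs => lt_of_lt_of_le hs.2 hβ) (subset_univ _)
  have hmeas3 : AEMeasurable (fun z : ℝ × EuclideanSpace ℝ (Fin 3) => ‖u z.1 z.2‖ₑ ^ (3 : ℕ))
      (volume.restrict (W ×ˢ ball (0 : EuclideanSpace ℝ (Fin 3)) a)) :=
    ((hum.mono_measure (Measure.restrict_mono hWs le_rfl)).aemeasurable.enorm.pow_const _)
  have hΓA : Γ * A₁ = ENNReal.ofReal (Γ.toReal * a ^ σ) := by
    rw [ENNReal.ofReal_mul ENNReal.toReal_nonneg, ENNReal.ofReal_toReal hΓt]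
  rw [← hΓA, lintegral_add_left' hmeas3, lintegral_const_mul' _ _ (by norm_num), hΓ, add_mul, mul_assoc (2 : ℝ≥0∞)]
  exact add_le_add h1 (mul_le_mul' le_rfl hPle)

end Summit.NavierStokesRegularity.NavierStokesRegularity.Theorems.PowerGaugeEulerLiouville

end
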